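import Summits.NavierStokesRegularity.NavierStokesRegularity.Theorems.PerpetualPumpAveragedTypeIBlowupPulseBootStep

/-!
# Crux `PerpetualPump.AveragedTypeIBlowup` (stmt-NavierStokesRegularity-1835), line `Sketch`:
# stub `pulseBoot` — THE PULSE-PHASE BOOTSTRAP of the window one-step theorem

Final file of the proof of the registered stub `stub_pulseBoot` (line `Sketch`): after the first
ignition of the front bond, on every truncated pulse horizon every mode of the critical Toda system
with memory errors stays in the box `Pul` — joint continuous induction on the loose bounds (closed
conditions, true at the ignition time by the pre-ignition box `Pre`), each step `pulseBoot_step`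
producing the tight boxes, which lie strictly inside the loose ones.

## References

T. Tao, *Finite time blowup for an averaged three-dimensional Navier–Stokes equation*, J. Amer.
Math. Soc. 29 (2016), 601–674, §5–6 (the cascade / transfer-pulse heuristics); the content here is
folklore ODE calculus (comparison, Duhamel bounds, continuous induction).
-/

noncomputable section

-- the summit namespace `…NavierStokesRegularity.NavierStokesRegularity…` is the tree convention
set_option linter.dupNamespace false

open Set MeasureTheory Filter Topology

namespace Summit.NavierStokesRegularity.NavierStokesRegularity.Theorems.PerpetualPumpAveragedTypeIBlowup

set_option maxHeartbeats 1600000 in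
/-- **Registered stub `stub_pulseBoot`** (line `Sketch` of crux `PerpetualPump.AveragedTypeIBlowup`,
stmt-NavierStokesRegularity-1835): THE PULSE-PHASE BOOTSTRAP of the window one-step theorem. After
the first ignition of the front bond at `tι` (pre-ignition box `Pre` on `[t₀, tι]`, `w_n² = b_n/100`
at `tι` with `b_n(tι) ≥ 10⁴`), on every truncated pulse horizon `[tι, t'']`,
`t'' ≤ tι + σ_P/R_n`, `σ_P = (5 log b_n(tι) + 20)/b_n(tι)`, every mode stays in the box `Pul`:
joint continuous induction on `s ∈ [tι, t'']` for the 2× LOOSER bounds (closed conditions, true at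
`tι` by `Pre`), each step `pulseBoot_step` deriving the TIGHT boxes — which lie strictly inside
the loose ones, so that by continuity the loose bounds extend a little further. [folklore] -/
theorem stub_pulseBoot :
    ∀ (ε₀ D εb θ η F blo bhi : ℝ) (n₀ : ℤ) (bv wv M0 M1 db dw : ℤ → ℝ → ℝ) (q : ℝ) (R : ℤ → ℝ) (lad : ℕ → ℝ)
      (G0 G1 : ℤ → ℝ → ℝ) (Inv : ℤ → ℝ → ℝ → Prop) (Tube : ℤ → ℝ → Prop) (n : ℤ) (B t₀ T : ℝ),
      q = Real.sqrt (1 + ε₀) → (∀ k : ℤ, R k = D * (1 + ε₀) ^ (2 * k)) →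
      (∀ j : ℕ, lad j = εb * ((1 + ε₀) ^ (19 * (j - 2)))⁻¹) →
      (∀ (k : ℤ) (t : ℝ), G0 k t = (wv (k - 1) t) ^ 2 / q ^ 3 - (wv k t) ^ 2 - εb * bv k t * wv k t) →
      (∀ (k : ℤ) (t : ℝ), G1 k t = wv k t * (bv k t - bv (k + 1) t / q) + εb * (bv k t) ^ 2) →
      (∀ (m : ℤ) (Bm t : ℝ), Inv m Bm t ↔
        (bv m t = Bm ∧ (∀ s ∈ Icc 0 t, bv m s ≤ Bm) ∧
        (0 ≤ wv m t ∧ wv m t ≤ F * εb * Bm ∧ M1 m t ≤ F * εb * Bm ∧ M0 m t ≤ 2 * Bm) ∧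
        (n₀ ≤ m - 1 → 0 ≤ wv (m - 1) t ∧ q ^ 3 * Bm - 1 ≤ (wv (m - 1) t) ^ 2 ∧
          (wv (m - 1) t) ^ 2 ≤ q ^ 3 * Bm + 1 ∧ 9 / 20 ≤ bv (m - 1) t ∧ bv (m - 1) t ≤ 11 / 20 ∧
          M0 (m - 1) t ≤ 5 * (bhi + 4) ^ 2 ∧ M1 (m - 1) t ≤ 5 * (bhi + 4) ^ 2) ∧
        (|bv (m + 1) t| ≤ εb ∧ |wv (m + 1) t| ≤ εb ∧ M0 (m + 1) t ≤ εb ∧ M1 (m + 1) t ≤ εb) ∧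
        (∀ j : ℕ, 2 ≤ j → |bv (m + j) t| ≤ lad j ∧ |wv (m + j) t| ≤ lad j / 5 ∧
          M0 (m + j) t ≤ lad j ∧ M1 (m + j) t ≤ lad j) ∧
        (∀ j : ℕ, 1 ≤ j → ∀ s ∈ Icc 0 t, bv (m + j) s ≤ 1 / 2) ∧
        (∀ k : ℤ, n₀ ≤ k → k ≤ m - 2 → ∃ te ∈ Icc 0 t,
          (-(2 / 5) ≤ bv k te ∧ bv k te ≤ 3 / 10 ∧ |wv k te| ≤ 1 / 200 ∧
            M0 k te ≤ 10 * (bhi + 4) ^ 2 ∧ M1 k te ≤ 10 * (bhi + 4) ^ 2) ∧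
          ∀ s ∈ Icc te t, -(9 / 20) ≤ bv k s ∧ bv k s ≤ 7 / 20 ∧ |wv k s| ≤ 1 / 100 ∧
            M0 k s ≤ 10 * (bhi + 4) ^ 2 + 1 ∧ M1 k s ≤ 10 * (bhi + 4) ^ 2 + 1 ∧ |wv (k - 1) s| ≤ 1 / 100 ∧
            -(1 / 2) ≤ bv (k + 1) s ∧ bv (k + 1) s ≤ 9 / 10))) →
      (∀ (m : ℤ) (t : ℝ), Tube m t ↔
        ((∀ k : ℤ, k ≤ m + 1 → |bv k t| ≤ 2 * (bhi + 3) ∧ |wv k t| ≤ 2 * (bhi + 3) ∧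
          M0 k t ≤ 20 * (bhi + 4) ^ 2 ∧ M1 k t ≤ 20 * (bhi + 4) ^ 2) ∧
        (∀ j : ℕ, 2 ≤ j → |bv (m + j) t| ≤ lad j ∧ |wv (m + j) t| ≤ lad j ∧
          M0 (m + j) t ≤ lad j ∧ M1 (m + j) t ≤ lad j))) →
      -- regime
      0 < ε₀ → ε₀ ≤ 1 / 20 → 0 < D → 1 / 2 ≤ θ → θ ≤ 1 → 0 ≤ η → 0 < εb → εb ≤ 1 / 10 ^ 6 →
      10 ^ 4 + 40 - 5 * Real.log εb ≤ blo → 10 ^ 9 * (bhi + 4) ^ 4 ≤ F →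
      η * (10 ^ 9 * (bhi + 4) ^ 4 * (F + 1)) ≤ 1 → εb * (10 ^ 9 * (F + 1) ^ 2 * (bhi + 4) ^ 3) ≤ 1 →
      10 ^ 3 + 20 * Real.log (bhi + 5) + Real.log (F + 2) ≤ -Real.log εb →
      -- the critical system with memory errors on [0, T]
      n₀ ≤ n → 0 ≤ t₀ → t₀ < T → blo ≤ B → B ≤ bhi →
      (∀ k : ℤ, k < n₀ → ∀ t ∈ Icc 0 T, bv k t = 0 ∧ wv k t = 0 ∧ M0 k t = 0 ∧ M1 k t = 0) →
      (∀ k : ℤ, ContinuousOn (bv k) (Icc 0 T) ∧ ContinuousOn (wv k) (Icc 0 T) ∧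
        ContinuousOn (M0 k) (Icc 0 T) ∧ ContinuousOn (M1 k) (Icc 0 T)) →
      (∀ k : ℤ, ContinuousOn (db k) (Icc 0 T) ∧ ContinuousOn (dw k) (Icc 0 T) ∧
        ∀ t ∈ Ioo 0 T, HasDerivAt (bv k) (db k t) t ∧
          |db k t - R k * (-(bv k t) + G0 k t)| ≤ η * R k * M0 k t ∧
          HasDerivAt (wv k) (dw k t) t ∧ |dw k t - R k * (-(wv k t) + G1 k t)| ≤ η * R k * M1 k t) →
      (∀ k : ℤ, ∀ t ∈ Icc 0 T, |bv k t| ≤ M0 k t ∧ |wv k t| ≤ M1 k t ∧ 0 ≤ M0 k t ∧ 0 ≤ M1 k t) →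
      (∀ k : ℤ, ∀ t₁ ∈ Icc 0 T, ∀ t₂ ∈ Icc t₁ T,
        M0 k t₂ ≤ M0 k t₁ * Real.exp (-(θ * R k * (t₂ - t₁))) +
          R k * ∫ u in t₁..t₂, Real.exp (-(θ * R k * (t₂ - u))) * |G0 k u| ∧
        M1 k t₂ ≤ M1 k t₁ * Real.exp (-(θ * R k * (t₂ - t₁))) +
          R k * ∫ u in t₁..t₂, Real.exp (-(θ * R k * (t₂ - u))) * |G1 k u|) →
      -- the a-priori far tail above the front, and the hand-off invariant at t₀
      (∃ J : ℕ, ∀ j : ℕ, J ≤ j → ∀ t ∈ Icc 0 T,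
        |bv (n + j) t| ≤ lad j ∧ |wv (n + j) t| ≤ lad j / 5 ∧ M0 (n + j) t ≤ lad j ∧ M1 (n + j) t ≤ lad j) →
      Inv n B t₀ →
      ∀ (Pre Pul : ℝ → Prop) (tι t'' : ℝ),
      (∀ s : ℝ, Pre s ↔
        ((B * Real.exp (-(R n * (s - t₀))) - 3 / 2 ≤ bv n s ∧ bv n s ≤ B * Real.exp (-(R n * (s - t₀))) + 5 / 2 ∧
          0 ≤ wv n s ∧ M0 n s ≤ 6 * (B + 3) ∧
          M1 n s ≤ F * εb * B + 2 * wv n s + 2 * εb * (B + 3) ^ 2 * (R n * (s - t₀))) ∧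
        (n₀ ≤ n - 1 → -(1 / 100) ≤ wv (n - 1) s ∧ (wv (n - 1) s) ^ 2 ≤ q ^ 3 * B + 2 ∧
          -(2 / 5) ≤ bv (n - 1) s ∧ bv (n - 1) s ≤ 17 / 20 ∧
          (t₀ + 2 * (100 + 4 * Real.log (bhi + 5)) / (B * R n) ≤ s → |wv (n - 1) s| ≤ 1 / 200 ∧ bv (n - 1) s ≤ 3 / 10) ∧
          M0 (n - 1) s ≤ 6 * (bhi + 4) ^ 2 ∧ M1 (n - 1) s ≤ 6 * (bhi + 4) ^ 2 ∧
          (1 + ε₀) ^ (-(2 : ℤ)) * R n * ∫ u in t₀..s, (wv (n - 1) u) ^ 2 ≤ 9 / 10) ∧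
        (|bv (n + 1) s| ≤ εb + q / 100 + 1 / 10 ^ 3 ∧ |wv (n + 1) s| ≤ 11 / 10 * εb ∧
          M0 (n + 1) s ≤ εb + (B + 3) / 40 ∧ M1 (n + 1) s ≤ 4 * εb) ∧
        (∀ j : ℕ, 2 ≤ j → |bv (n + j) s| ≤ lad j ∧ |wv (n + j) s| ≤ lad j / 5 ∧
          M0 (n + j) s ≤ lad j ∧ M1 (n + j) s ≤ lad j) ∧
        (∀ k : ℤ, n₀ ≤ k → k ≤ n - 2 → -(9 / 20) ≤ bv k s ∧ bv k s ≤ 7 / 20 ∧ |wv k s| ≤ 1 / 100 ∧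
          M0 k s ≤ 10 * (bhi + 4) ^ 2 + 1 ∧ M1 k s ≤ 10 * (bhi + 4) ^ 2 + 1))) →
      (∀ s : ℝ, Pul s ↔
        ((-(1 / 2) ≤ bv n s ∧ bv n s ≤ bv n tι + 1 / 100 ∧ |wv n s| ≤ bv n tι + 1 / 100 ∧
          -(q / 50) ≤ bv (n + 1) s ∧ bv (n + 1) s ≤ q * (bv n tι + 1 / 100) ∧
          M0 n s ≤ 3 * (bhi + 4) ^ 2 ∧ M1 n s ≤ 5 * (bhi + 4) ^ 2 ∧ M0 (n + 1) s ≤ 3 / 2 * B ∧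
          |wv (n + 1) s| ≤ 1 / 10 ^ 3 ∧ M1 (n + 1) s ≤ 1) ∧
        (n₀ ≤ n - 1 → |wv (n - 1) s| ≤ 1 / 200 ∧ -(2 / 5) ≤ bv (n - 1) s ∧ bv (n - 1) s ≤ 3 / 10 ∧
          M0 (n - 1) s ≤ 6 * (bhi + 4) ^ 2 ∧ M1 (n - 1) s ≤ 6 * (bhi + 4) ^ 2 ∧
          (1 + ε₀) ^ (-(2 : ℤ)) * R n * ∫ u in t₀..s, (wv (n - 1) u) ^ 2 ≤ 9 / 10) ∧
        (∀ j : ℕ, 2 ≤ j → |bv (n + j) s| ≤ lad j ∧ |wv (n + j) s| ≤ lad j / 5 ∧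
          M0 (n + j) s ≤ lad j ∧ M1 (n + j) s ≤ lad j) ∧
        (∀ k : ℤ, n₀ ≤ k → k ≤ n - 2 → -(9 / 20) ≤ bv k s ∧ bv k s ≤ 7 / 20 ∧ |wv k s| ≤ 1 / 100 ∧
          M0 k s ≤ 10 * (bhi + 4) ^ 2 + 1 ∧ M1 k s ≤ 10 * (bhi + 4) ^ 2 + 1))) →
      t₀ < tι → tι ≤ t₀ + 3 / R n → t₀ + 2 * (100 + 4 * Real.log (bhi + 5)) / (B * R n) ≤ tι → 10 ^ 4 ≤ bv n tι →
      (∀ s ∈ Icc t₀ tι, Pre s) → (∀ s ∈ Ioc t₀ tι, 0 < wv n s) → (R n * ∫ u in t₀..tι, (wv n u) ^ 2 ≤ 1 / 100) →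
      (∀ s ∈ Icc t₀ tι, (wv n s) ^ 2 ≤ bv n s / 100) → (wv n tι) ^ 2 = bv n tι / 100 →
      bv n tι ≤ B + Real.log (10 * (F + 2) * εb * B) + 6 * (R n * (tι - t₀) + 1) →
      B * (1 - Real.exp (-(R n * (tι - t₀)))) ≤
        max 0 (Real.log (6 / 10 * Real.sqrt (B + 4) / (εb * B))) + 6 * (R n * (tι - t₀) + 1) + 2 →
      tι < t'' → t'' ≤ T → t'' ≤ tι + (5 * Real.log (bv n tι) + 20) / bv n tι / R n →
      ∀ s ∈ Icc tι t'', Pul s := by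
  intro ε₀ D εb θ η F blo bhi n₀ bv wv M0 M1 db dw q R lad G0 G1 Inv Tube n B t₀ T hq hR hlad hG0 hG1
    hInv hTube hε₀ hε₀' hD hθ hθ1 hη hεb hεb6 hblo hF hηreg hεbreg hseed hn₀ ht₀ ht₀T hBlo hBhi hzero
    hcont hC1 hmaj hrest hTail hInvt Pre Pul tι t'' hPre hPul htι htι3 hσI hB' hPreι hpos hbud hnoig
    hig hN1 hN2 htt ht''T ht''P
  obtain ⟨hεb1, hB4, hB1, hF0, hFεB, hεbhi, hq1, hq21⟩ :=
    oneStepCore_regime hε₀ hε₀' hεb hεb6 hblo hF hεbreg hBlo hBhi hq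
  have hbhi : 1 ≤ bhi + 4 := by linarith
  obtain ⟨hRpos, -, -, -, -, -, -, -, -, hq0, -⟩ := preBoot_rates hε₀ hε₀' hD hR hq n
  have hRn := hRpos n
  obtain ⟨hY0, hY2, hY3, hY20, hYε, -⟩ := pulseBoot_Y hεb hF0 hbhi hseed
  set Y₁ := Real.exp 25 * εb * (bhi + 4) ^ 8 with hY₁
  have hT : 0 < T := by linarith
  have htι0 : 0 ≤ tι := by linarith
  have hsubT : Icc tι t'' ⊆ Icc 0 T := fun u hu => ⟨htι0.trans hu.1, hu.2.trans ht''T⟩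
  -- the loose predicate
  obtain ⟨Lo, hLo⟩ : ∃ Lo : ℝ → Prop, ∀ u, Lo u ↔
      ((|wv (n - 1) u| ≤ 1 / 100 ∧ -(1 / 2) ≤ bv (n - 1) u ∧ bv (n - 1) u ≤ 9 / 10) ∧
        (|bv n u| ≤ 2 * (bhi + 4) ∧ |wv n u| ≤ 2 * (bhi + 4) ∧ M0 n u ≤ 6 * (bhi + 4) ^ 2 ∧
          M1 n u ≤ 10 * (bhi + 4) ^ 2) ∧
        (|bv (n + 1) u| ≤ 3 * (bhi + 4) ∧ |wv (n + 1) u| ≤ 2 * (Real.exp 25 * εb * (bhi + 4) ^ 8) ∧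
          M0 (n + 1) u ≤ 3 * B) ∧ |bv (n + 2) u| ≤ 1 / 2 ∧
        (∀ k : ℤ, n₀ ≤ k → k ≤ n - 2 → |wv k u| ≤ 1 / 50 ∧ -(1 / 2) ≤ bv k u ∧ bv k u ≤ 9 / 10)) := ⟨fun u => _, fun u => Iff.rfl⟩
  -- one step: loose on `[tι, S]` gives tight on `[tι, S]`
  have hstep : ∀ S ∈ Icc tι t'', (∀ u ∈ Icc tι S, Lo u) →
      ∀ u ∈ Icc tι S, Pul u ∧ |wv (n + 1) u| ≤ Y₁ := fun S hS h =>
    pulseBoot_step ε₀ D εb θ η F blo bhi n₀ bv wv M0 M1 db dw q R lad G0 G1 Inv Tube n B t₀ T hq hR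
      hlad hG0 hG1 hInv hTube hε₀ hε₀' hD hθ hθ1 hη hεb hεb6 hblo hF hηreg hεbreg hseed hn₀ ht₀ ht₀T
      hBlo hBhi hzero hcont hC1 hmaj hrest hTail hInvt Pre Pul tι S hPre hPul htι htι3 hσI hB' hPreι
      hpos hbud hnoig hig hN1 hN2 hS.1 (hS.2.trans ht''T) (hS.2.trans ht''P)
      (fun u hu => (hLo u).1 (h u hu))
  -- the loose bounds at the ignition time, from the pre-ignition box
  have hPre' : ∀ s ∈ Icc t₀ tι, _ := fun s hs => (hPre s).1 (hPreι s hs)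
  have hLoι : Lo tι := by
    obtain ⟨⟨f1, f2, f3, f4, f5⟩, pp, ⟨l1, l2, l3, l4⟩, ld, tr⟩ := hPre' tι ⟨htι.le, le_rfl⟩
    obtain ⟨hclock3, -, -, -, -⟩ := oneStepCore_clock (t₀ := t₀) hRn
    have hσι3 : R n * (tι - t₀) ≤ 3 := hclock3 tι htι3
    have hσ0 : 0 ≤ R n * (tι - t₀) := mul_nonneg hRn.le (by linarith)
    have hBe := oneStepCore_mul_exp_neg_le (by linarith : 0 ≤ B) hσ0
    have hB'B : bv n tι ≤ B + 5 / 2 := by linarith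
    have hwv : |wv n tι| ≤ bv n tι := by
      refine abs_le_of_sq_le_sq ?_ (by linarith)
      rw [hig]
      nlinarith
    have hw0 : 0 ≤ wv n tι := f3
    have hεB3 : εb * (B + 3) ^ 2 ≤ 1 := by
      have : εb * (B + 3) ^ 2 ≤ εb * (bhi + 4) ^ 2 :=
        mul_le_mul_of_nonneg_left (pow_le_pow_left₀ (by linarith) (by linarith) 2) hεb.le
      linarith
    have hsq : (bhi + 4) ^ 2 = bhi ^ 2 + 8 * bhi + 16 := by ring
    have hb2 : 0 ≤ bhi ^ 2 := sq_nonneg _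
    have hlad2 : lad 2 = εb := by rw [hlad]; norm_num
    refine (hLo tι).2 ⟨?_, ⟨abs_le.2 ⟨by linarith, by linarith⟩, hwv.trans (by linarith), ?_, ?_⟩,
      ⟨l1.trans (by linarith), l2.trans (by linarith), by linarith⟩, ?_, fun k hk1 hk2 => ?_⟩
    · by_cases hn1 : n₀ ≤ n - 1
      · obtain ⟨-, -, a3, a4, a5, -⟩ := pp hn1
        obtain ⟨b1, -⟩ := a5 hσI
        exact ⟨b1.trans (by norm_num), by linarith, by linarith⟩
      · obtain ⟨z1, z2, -⟩ := hzero (n - 1) (by omega) tι ⟨htι0, by linarith⟩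
        rw [z1, z2, abs_zero]
        norm_num
    · rw [hsq]; linarith
    · have : 2 * εb * (B + 3) ^ 2 * (R n * (tι - t₀)) ≤ 2 * 1 * 3 := by
        have h1 : 2 * εb * (B + 3) ^ 2 * (R n * (tι - t₀)) ≤ 2 * εb * (B + 3) ^ 2 * 3 :=
          mul_le_mul_of_nonneg_left hσι3 (by positivity)
        linarith
      have hwle : wv n tι ≤ bhi + 3 := by linarith [(abs_le.1 hwv).2]
      rw [hsq]; linarith
    · have := (ld 2 le_rfl).1
      rw [hlad2] at this
      push_cast at this
      exact this.trans (by linarith)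
    · obtain ⟨a1, a2, a3, -⟩ := tr k hk1 hk2
      exact ⟨a3.trans (by norm_num), by linarith, by linarith⟩
  -- the induction
  have key := preBoot_induction (P := fun t => ∀ u ∈ Icc tι t, Lo u) htt.le
    (fun u hu => by rw [le_antisymm hu.2 hu.1]; exact hLoι) ?_ ?_
  · intro s hs
    exact ((hstep t'' ⟨htt.le, le_rfl⟩ (key t'' ⟨htt.le, le_rfl⟩)) s hs).1
  · -- closedness: the loose bounds are closed conditions
    intro t ht hP
    have hLo' : ∀ u ∈ Ico tι t, Lo u := fun u hu => hP u hu u ⟨hu.1, le_rfl⟩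
    have htT : t ≤ T := ht.2.trans ht''T
    intro u hu
    rcases hu.2.lt_or_eq with hlt | heq
    · exact hLo' u ⟨hu.1, hlt⟩
    rw [heq]
    have hL := fun u hu => (hLo u).1 (hLo' u hu)
    have cl := fun {f g : ℝ → ℝ} (hf : ContinuousOn f (Icc 0 T)) (hg : ContinuousOn g (Icc 0 T)) =>
      pulseBoot_closed_le (a := tι) (t := t) hf hg htι0 ht.1 htT
    have habs : ∀ k, ContinuousOn (fun u => |wv k u|) (Icc 0 T) ∧ ContinuousOn (fun u => |bv k u|) (Icc 0 T) :=
      fun k => ⟨continuous_abs.comp_continuousOn (hcont k).2.1, continuous_abs.comp_continuousOn (hcont k).1⟩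
    refine (hLo t).2 ⟨⟨?_, ?_, ?_⟩, ⟨?_, ?_, ?_, ?_⟩, ⟨?_, ?_, ?_⟩, ?_, fun k hk1 hk2 => ⟨?_, ?_, ?_⟩⟩
    · exact cl (habs (n - 1)).1 continuousOn_const fun u hu => (hL u hu).1.1
    · exact cl continuousOn_const (hcont (n - 1)).1 fun u hu => (hL u hu).1.2.1
    · exact cl (hcont (n - 1)).1 continuousOn_const fun u hu => (hL u hu).1.2.2
    · exact cl (habs n).2 continuousOn_const fun u hu => (hL u hu).2.1.1
    · exact cl (habs n).1 continuousOn_const fun u hu => (hL u hu).2.1.2.1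
    · exact cl (hcont n).2.2.1 continuousOn_const fun u hu => (hL u hu).2.1.2.2.1
    · exact cl (hcont n).2.2.2 continuousOn_const fun u hu => (hL u hu).2.1.2.2.2
    · exact cl (habs (n + 1)).2 continuousOn_const fun u hu => (hL u hu).2.2.1.1
    · exact cl (habs (n + 1)).1 continuousOn_const fun u hu => (hL u hu).2.2.1.2.1
    · exact cl (hcont (n + 1)).2.2.1 continuousOn_const fun u hu => (hL u hu).2.2.1.2.2
    · exact cl (habs (n + 2)).2 continuousOn_const fun u hu => (hL u hu).2.2.2.1
    · exact cl (habs k).1 continuousOn_const fun u hu => ((hL u hu).2.2.2.2 k hk1 hk2).1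
    · exact cl continuousOn_const (hcont k).1 fun u hu => ((hL u hu).2.2.2.2 k hk1 hk2).2.1
    · exact cl (hcont k).1 continuousOn_const fun u hu => ((hL u hu).2.2.2.2 k hk1 hk2).2.2
  · -- openness: tight at `t` is strictly inside loose, and everything is continuous
    intro t ht hP0
    have hP : ∀ u ∈ Icc tι t, Lo u := fun u hu => hP0 u hu u ⟨hu.1, le_rfl⟩
    have htT : t ≤ T := ht.2.le.trans ht''T
    have ht' : t ∈ Icc tι t'' := ⟨ht.1, ht.2.le⟩
    have hTt := hstep t ht' hP t ⟨ht.1, le_rfl⟩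
    obtain ⟨⟨⟨a1, a2, a3, a4, a5, a6, a7, a8, -, -⟩, pp, ld, tr⟩, hy⟩ :=
      (show (_ ∧ _) from ⟨(hPul t).1 hTt.1, hTt.2⟩)
    have hB'B : bv n tι ≤ B + 5 / 2 := by
      obtain ⟨⟨-, f2, -⟩, -⟩ := hPre' tι ⟨htι.le, le_rfl⟩
      have := oneStepCore_mul_exp_neg_le (by linarith : 0 ≤ B)
        (mul_nonneg hRn.le (by linarith : 0 ≤ tι - t₀))
      linarith
    have hsq1 : 1 ≤ (bhi + 4) ^ 2 := one_le_pow₀ hbhi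
    have hlad2 : lad 2 = εb := by rw [hlad]; norm_num
    have op := fun {f : ℝ → ℝ} {C : ℝ} (hf : ContinuousOn f (Icc 0 T)) =>
      pulseBoot_open (C := C) hf hsubT ht'
    have habs : ∀ k, ContinuousOn (fun u => |wv k u|) (Icc 0 T) ∧ ContinuousOn (fun u => |bv k u|) (Icc 0 T) :=
      fun k => ⟨continuous_abs.comp_continuousOn (hcont k).2.1, continuous_abs.comp_continuousOn (hcont k).1⟩
    -- strict values at `t`
    have v1 : |wv (n - 1) t| < 1 / 100 ∧ -(1 / 2) < bv (n - 1) t ∧ bv (n - 1) t < 9 / 10 := by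
      by_cases hn1 : n₀ ≤ n - 1
      · obtain ⟨p1, p2, p3, -⟩ := pp hn1
        exact ⟨p1.trans_lt (by norm_num), by linarith, by linarith⟩
      · obtain ⟨z1, z2, -⟩ := hzero (n - 1) (by omega) t ⟨htι0.trans ht.1, htT⟩
        rw [z1, z2, abs_zero]
        norm_num
    have v4 : |bv n t| < 2 * (bhi + 4) := abs_lt.2 ⟨by linarith, by linarith⟩
    have v5 : |wv n t| < 2 * (bhi + 4) := a3.trans_lt (by linarith)
    have v8 : |bv (n + 1) t| < 3 * (bhi + 4) := by
      have : q * (bv n tι + 1 / 100) ≤ 21 / 20 * (bv n tι + 1 / 100) :=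
        mul_le_mul_of_nonneg_right hq21 (by linarith)
      exact abs_lt.2 ⟨by linarith, by linarith⟩
    have v11 : |bv (n + 2) t| < 1 / 2 := by
      have := (ld 2 le_rfl).1
      rw [hlad2] at this
      push_cast at this
      exact this.trans_lt (by linarith)
    have e1 := (op (habs (n - 1)).1).1 v1.1
    have e2 := (op (hcont (n - 1)).1).2 v1.2.1
    have e3 := (op (hcont (n - 1)).1).1 v1.2.2
    have e4 := (op (habs n).2).1 v4
    have e5 := (op (habs n).1).1 v5
    have e6 := (op (hcont n).2.2.1).1 (show M0 n t < 6 * (bhi + 4) ^ 2 by linarith)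
    have e7 := (op (hcont n).2.2.2).1 (show M1 n t < 10 * (bhi + 4) ^ 2 by linarith)
    have e8 := (op (habs (n + 1)).2).1 v8
    have e9 := (op (habs (n + 1)).1).1 (show |wv (n + 1) t| < 2 * Y₁ by linarith)
    have e10 := (op (hcont (n + 1)).2.2.1).1 (show M0 (n + 1) t < 3 * B by linarith)
    have e11 := (op (habs (n + 2)).2).1 v11
    have e12 : ∀ᶠ u in 𝓝[Icc tι t''] t, ∀ k ∈ Set.Icc n₀ (n - 2),
        |wv k u| ≤ 1 / 50 ∧ -(1 / 2) ≤ bv k u ∧ bv k u ≤ 9 / 10 := by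
      rw [Filter.eventually_all_finite (Set.finite_Icc n₀ (n - 2))]
      intro k hk
      obtain ⟨t1, t2, t3, -⟩ := tr k hk.1 hk.2
      have f1 := (op (habs k).1).1 (t3.trans_lt (by norm_num : (1:ℝ) / 100 < 1 / 50))
      have f2 := (op (hcont k).1).2 (show -(1 / 2 : ℝ) < bv k t by linarith)
      have f3 := (op (hcont k).1).1 (show bv k t < 9 / 10 by linarith)
      filter_upwards [f1, f2, f3] with u g1 g2 g3
      exact ⟨g1, g2, g3⟩
    have hev : ∀ᶠ u in 𝓝[Icc tι t''] t, Lo u := by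
      filter_upwards [e1, e2, e3, e4, e5, e6, e7, e8, e9, e10, e11, e12] with u g1 g2 g3 g4 g5 g6 g7
        g8 g9 g10 g11 g12
      exact (hLo u).2 ⟨⟨g1, g2, g3⟩, ⟨g4, g5, g6, g7⟩, ⟨g8, g9, g10⟩, g11,
        fun k hk1 hk2 => g12 k ⟨hk1, hk2⟩⟩
    obtain ⟨δ, hδ, hδP⟩ := preBoot_eventually_delta hev ht
    refine ⟨δ, hδ, fun u hu hut v hv => ?_⟩
    rcases le_or_gt v t with h | h
    · exact hP v ⟨hv.1, h⟩
    · exact hδP v ⟨h, hv.2.trans hu.2⟩ (hv.2.trans hut)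

/-- **Registered marker sub-goal `stub_pulseBootMarker`** of the stub `pulseBoot` (line `Sketch`,
crux stmt-NavierStokesRegularity-1835; the registered signature of `stub_pulseBoot` itself exceeds
the registry's length limit, so this file is booked through the marker): the loose pulse-phase size
of the next bond is negligible, `2Y₁ = 2e^{25} ε̄ (b_hi+4)⁸ ≤ 1/100` (`pulseBoot_Y`). [folklore] -/
theorem stub_pulseBootMarker :
    ∀ (εb F bhi : ℝ), 0 < εb → 0 ≤ F → 1 ≤ bhi + 4 →
      10 ^ 3 + 20 * Real.log (bhi + 5) + Real.log (F + 2) ≤ -Real.log εb →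
      2 * (Real.exp 25 * εb * (bhi + 4) ^ 8) ≤ 1 / 100 :=
  fun _ _ _ hεb hF hbhi hseed => (pulseBoot_Y hεb hF hbhi hseed).2.1

end Summit.NavierStokesRegularity.NavierStokesRegularity.Theorems.PerpetualPumpAveragedTypeIBlowup

end
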